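import Mathlib
import HarnessLib

/-! # Stub `helper_sublevelLayerCake` of line `Sketch` (crux `EntropyRung.ConicalGap`, stmt-SmoothPoincare4-16589)

Pure measure theory (cycle 5, localisation to sublevel sets). For a measure `μ` on a measurable
space `X` and a measurable `f ≥ 0` all of whose strict sublevel sets `{f < s}` have finite
measure, and every level `t ≥ 0`:

* `t − f` is integrable on `{f < t}` (it takes values in `(0, t]` there, and `μ {f < t} < ∞`);
* the LAYER-CAKE identity `∫_{f<t} (t − f) dμ = ∫₀ᵗ μ{f < s} ds`.

This is what turns the exact sublevel identity `∫_{f<t} (2t − 3f + (1+f−t)R) dV = 0` on a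
gradient shrinking Ricci soliton into an ODE for the volume profile `V(t) = Vol{f<t}` and its
primitive `A(t) = ∫₀ᵗ V(s) ds` (`∫_{f<t} f = tV(t) − A(t)`).

How. Cavalieri (`MeasureTheory.Integrable.integral_eq_integral_meas_lt`) for the nonnegative
integrable function `t − f` w.r.t. `μ.restrict {f < t}` gives `∫_{f<t} (t − f) = ∫_{s>0}
μ({s < t − f} ∩ {f < t}) ds`; for `s > 0` the set is `{f < t − s}`, which is empty once `s > t`
(`f ≥ 0`), so the `ds`-integral lives on `Ioc 0 t` = the interval integral `∫₀ᵗ`, and the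
substitution `s ↦ t − s` (`intervalIntegral.integral_comp_sub_left`) finishes. No integrability
of `s ↦ μ{f < s}` is needed along the way (all rewriting lemmas are unconditional).

Everything here is proved; no definition and no named fact is introduced.
-/

noncomputable section

set_option linter.dupNamespace false

open MeasureTheory Set Filter

namespace Summit.SmoothPoincare4.SmoothPoincare4.Theorems.ConicalGapSketch

/-- Integrability half: on `{f < t}` the function `t − f` takes values in `(0, t]` (as `f ≥ 0`),
and `{f < t}` has finite measure, so `t − f` is integrable there
(`Measure.integrableOn_of_bounded`). -/
theorem sublevelLayerCake_integrableOn {X : Type*} [MeasurableSpace X] (μ : Measure X)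
    (f : X → ℝ) (hf : Measurable f) (hf0 : ∀ x, 0 ≤ f x) (t : ℝ)
    (hfin : μ {x | f x < t} < ⊤) :
    IntegrableOn (fun x ↦ t - f x) {x | f x < t} μ := by
  have hS : MeasurableSet {x | f x < t} := measurableSet_lt hf measurable_const
  refine Measure.integrableOn_of_bounded (M := t) hfin.ne
    (measurable_const.sub hf).aestronglyMeasurable ?_
  refine (ae_restrict_iff' hS).2 (Eventually.of_forall fun x hx ↦ ?_)
  have hx' : f x < t := hx
  rw [Real.norm_eq_abs, abs_of_nonneg (by linarith)]
  linarith [hf0 x]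

/-- Identity half (layer cake / Cavalieri): for measurable `f ≥ 0` with `μ {f < t} < ∞` and
`0 ≤ t`, `∫_{f<t} (t − f) dμ = ∫₀ᵗ μ{f < s} ds`. -/
theorem sublevelLayerCake_integral_eq {X : Type*} [MeasurableSpace X] (μ : Measure X)
    (f : X → ℝ) (hf : Measurable f) (hf0 : ∀ x, 0 ≤ f x) (t : ℝ) (ht : 0 ≤ t)
    (hfin : μ {x | f x < t} < ⊤) :
    ∫ x in {x | f x < t}, (t - f x) ∂μ = ∫ s in (0 : ℝ)..t, (μ {x | f x < s}).toReal := by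
  have hS : MeasurableSet {x | f x < t} := measurableSet_lt hf measurable_const
  have hint := sublevelLayerCake_integrableOn μ f hf hf0 t hfin
  have hnn : 0 ≤ᵐ[μ.restrict {x | f x < t}] fun x ↦ t - f x := by
    refine (ae_restrict_iff' hS).2 (Eventually.of_forall fun x hx ↦ ?_)
    have hx' : f x < t := hx
    simp only [Pi.zero_apply]
    linarith
  -- Cavalieri for `t - f` w.r.t. `μ.restrict {f < t}`
  have hlc : ∫ x in {x | f x < t}, (t - f x) ∂μ
      = ∫ s in Ioi 0, (μ.restrict {x | f x < t}).real {a | s < t - f a} :=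
    hint.integral_eq_integral_meas_lt hnn
  rw [hlc]
  -- identify the superlevel sets of `t - f` inside `{f < t}` with sublevel sets of `f`
  have hlevel : EqOn (fun s ↦ (μ.restrict {x | f x < t}).real {a | s < t - f a})
      (fun s ↦ (μ {a | f a < t - s}).toReal) (Ioi (0 : ℝ)) := by
    intro s hs
    have hs' : 0 < s := hs
    have hA : MeasurableSet {a | s < t - f a} :=
      measurableSet_lt measurable_const (measurable_const.sub hf)
    simp only
    rw [measureReal_restrict_apply hA, measureReal_def]
    congr 2
    ext a
    simp only [mem_inter_iff, mem_setOf_eq]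
    constructor
    · rintro ⟨h1, _⟩
      linarith
    · intro h
      exact ⟨by linarith, by linarith⟩
  rw [setIntegral_congr_fun measurableSet_Ioi hlevel]
  -- the integrand vanishes for `s > t` (`f ≥ 0`), so restrict `Ioi 0` to `Ioc 0 t`
  have hvan : ∀ s ∈ Ioi (0 : ℝ) \ Ioc 0 t, (μ {a | f a < t - s}).toReal = 0 := by
    intro s hs
    have hst : t < s := not_le.1 fun h ↦ hs.2 ⟨hs.1, h⟩
    have he : {a | f a < t - s} = ∅ := by
      ext a
      simp only [mem_setOf_eq, mem_empty_iff_false, iff_false, not_lt]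
      linarith [hf0 a]
    rw [he, measure_empty, ENNReal.toReal_zero]
  rw [setIntegral_eq_of_subset_of_forall_sdiff_eq_zero measurableSet_Ioi
      (Ioc_subset_Ioi_self : Ioc (0 : ℝ) t ⊆ Ioi 0) hvan]
  -- back to an interval integral and substitute `s ↦ t - s`
  rw [← intervalIntegral.integral_of_le ht]
  have hsub := intervalIntegral.integral_comp_sub_left (a := 0) (b := t)
    (fun u ↦ (μ {a | f a < u}).toReal) t
  simp only [sub_self, sub_zero] at hsub
  exact hsub

/-- **Stub `helper_sublevelLayerCake` (W2a) of line `Sketch`.** For a measure `μ` and a measurable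
`f ≥ 0` whose strict sublevel sets `{f < s}` all have finite measure, and every `t ≥ 0`:
`t − f` is integrable on `{f < t}` and the layer-cake identity
`∫_{f<t} (t − f) dμ = ∫₀ᵗ μ{f < s} ds` holds. -/
theorem helper_sublevelLayerCake : ∀ (X : Type) [MeasurableSpace X] (μ : MeasureTheory.Measure X) (f : X → ℝ), Measurable f → (∀ x, 0 ≤ f x) → (∀ s : ℝ, μ {x | f x < s} < ⊤) → ∀ t : ℝ, 0 ≤ t → MeasureTheory.IntegrableOn (fun x ↦ t - f x) {x | f x < t} μ ∧ ∫ x in {x | f x < t}, (t - f x) ∂μ = ∫ s in (0 : ℝ)..t, (μ {x | f x < s}).toReal := by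
  intro X _ μ f hf hf0 hfin t ht
  exact ⟨sublevelLayerCake_integrableOn μ f hf hf0 t (hfin t),
    sublevelLayerCake_integral_eq μ f hf hf0 t ht (hfin t)⟩

end Summit.SmoothPoincare4.SmoothPoincare4.Theorems.ConicalGapSketch

end
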